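import Mathlib
import Summits.ResolutionOfSingularities.ResolutionOfSingularities.Theorems.RadicialJungCleanModelsLens5TFrameTwoField3
import HarnessLib

/-!
# Route `RadicialJung`, crux `CleanModels` (stmt-15917): T″ port part 7/10 — `port_monomialModelInf` and §F∞ the base change `T⁺ = Σ_s b_s T` (`basechange_modelInf`)

PORT (line lead `res-B-lead-1` g8, for Sketch rev 33) of res-B-lens-5's crux workfiles `Cruxes/DescentPerfectToAll/Lens5_TPrimeInfCurrency.lean` rev 4
(crux 75ffdaa75b27; author res-B-lens-5 g14), the T″ theorem module prepared by the author from `Lens5_TPrimeInf.lean` rev 3 (HOME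
`B/res-B-lens-5/g14/PORTALPHA_TPrimeInf_theorem_module.lean`, sha16 48c5cb0bf6ec7b34, certified by the author's one-file simulation) and
`Cruxes/DescentPerfectToAll/Lens5_TPrimeConst.lean` rev 1 (4e5e6a0028c2): THEOREMS T′_∞ / T″ / T‴ — the slice {`[Γ:pΓ] = p²`, `K/k′` separably
generated and `κ_v/k′` SEPARABLE for some finite intermediate field of constants `k ⊆ k′ ⊆ K`} of the research stub `stub_cleanLU3DefectNonDiscrete`
(grounds of ARBITRARY, possibly infinite, `p`-rank), modulo F-02 `CossartPiltant2019` and F-32 (`hEmb`) only.  Continues the T⁗-family port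
(`…Lens5TFrame{Currency,…,PDegreeC}`): same namespace `Summit.ResolutionOfSingularities.ResolutionOfSingularities.Theorems.RadicialJungCleanModels.Lens5TFrame`,
declarations VERBATIM; the authors' copies of §B/§B′ (defs) and §C/§D (RG/IR lemmas) are NOT repeated — they are the landed `…Lens5TFrameCurrency` /
`…Lens5TFrameRG` / `…Lens5TFrameIR` declarations of the same names and statements; §C′/§B‴ (unused bridges) and the T′_fin/T′₁/«T″ ⊇ T» corollaries are not ported.
OURS · counted 0 · nothing here proves resolution in characteristic `p`.


-/

set_option linter.dupNamespace false -- mandated namespace of this single-conjunct summit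

noncomputable section

section

open IsLocalRing
open Literature.AlgebraicGeometry.Resolution
open Summit.ResolutionOfSingularities.ResolutionOfSingularities.Theorems.RadicialJung.CleanModels
open Summit.ResolutionOfSingularities.ResolutionOfSingularities.Theorems.RadicialJung.CleanModels.Lens5
open Summit.ResolutionOfSingularities.ResolutionOfSingularities.Theorems.RadicialJung.CleanModels.Lens5.PRankTwoCurrency
open Summit.ResolutionOfSingularities.ResolutionOfSingularities.Theorems.RadicialJung.CleanModels.Lens5.PRankTwoAssembly
open Summit.ResolutionOfSingularities.ResolutionOfSingularities.Theorems.RadicialJungCleanModels.Lens5RegularityCriterion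
open Summit.ResolutionOfSingularities.ResolutionOfSingularities.Theorems.RadicialJungCleanModels.Lens5ChartSurjection

namespace Summit.ResolutionOfSingularities.ResolutionOfSingularities.Theorems.RadicialJungCleanModels.Lens5TFrame

open AlgebraicGeometry CategoryTheory in
/-- **PORT 2′_∞ (monomialising model over `k₀ = k^p`, ARBITRARY imperfect `k`).**  Same OUTPUT as `Lens5_TPrime.lean` rev 3 `port_monomialModel'`
(generators `G₂ ⊆ O`, the subring `C = k^p[G₂]`, `T := locAtCentre C O ⊆ M` with a regular system of parameters `z` monomialising `F`), but
WITHOUT the finite `p`-spanning family `b` of rev 3: instead of re-basing `A` to `k₀ := k^p` (which needs `[k : k^p] < ∞`), the two-field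
core `TwoField.port_monomialModel_core₂` keeps `A` a `k`-algebra and runs F-02 / F-32 on the `k^p`-side (`k^p(t^p, g₁) = K^p(g₀)` has
transcendence degree `3` over `k^p` for ANY `k`).  PROVED; consumes `hLU : LocalUniformization3 ↥(frobenius k p).fieldRange` and `hEmb`.
[cite: CossartPiltant2019, Thm. 1.1; CossartJannsenSaito2020, Thm. 1.6.3 (F-32)] -/
theorem port_monomialModelInf (p : ℕ) [Fact p.Prime] {k : Type} [Field k] [CharP k p]
    {K : Type} [Field K] [Algebra k K] (hLU : LocalUniformization3 ↥(frobenius k p).fieldRange)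
    (hEmb : ∀ (Z : Scheme.{0}) [IsIntegral Z] [IsNoetherian Z], Scheme.IsRegular Z →
      Scheme.IsExcellent Z → ∀ (X : Set Z), IsClosed X → X ≠ Set.univ → topologicalKrullDim X ≤ 2 →
        ∃ (Z' : Scheme.{0}) (π : Z' ⟶ Z), IsProper π ∧ Function.Surjective π.base ∧
          (∃ U : Z.Opens, (U : Set Z) = Xᶜ ∧ IsIso (π ∣_ U)) ∧
          IsStrictNormalCrossingsDivisor Z' (π.base ⁻¹' X))
    (O : ValuationSubring K) (A : Subalgebra k K)
    (hAO : A.toSubring ≤ O.toSubring) (hAfg : A.FG) [IsFractionRing A K] (hdimA : ringKrullDim A ≤ 3)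
    (hdim3 : ringKrullDim (locAtCentre A.toSubring O) = 3)
    (hzd : ∀ (T : Subring K) (hT : T ≤ O.toSubring), A.toSubring ≤ T → (subringCentre T O hT).IsMaximal)
    (g₀ : K) (M : Subfield K) (hM : ∀ x : K, x ∈ M ↔ ∃ c : Fin p → K, ∑ j, c j ^ p * g₀ ^ (j : ℕ) = x)
    (F : Finset K) (hFM : ∀ f ∈ F, f ∈ M) (hF0 : ∀ f ∈ F, f ≠ 0) :
    ∃ (G₂ : Finset K) (C : Subring K), (∀ g ∈ G₂, g ∈ O) ∧
      C = Subring.closure (Set.range (fun c : k => algebraMap k K c ^ p) ∪ (G₂ : Set K)) ∧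
      (∀ a ∈ A, a ^ p ∈ C) ∧ (∀ r : K, r ∈ locAtCentre C O → r ∈ M) ∧
      ∃ (z : Fin 3 → K), (∀ i, z i ∈ locAtCentre C O) ∧ (∀ i, O.valuation (z i) < 1) ∧ (∀ i, z i ≠ 0) ∧
        (∀ r : K, r ∈ locAtCentre C O → O.valuation r < 1 →
          ∃ b : Fin 3 → K, (∀ i, b i ∈ locAtCentre C O) ∧ r = ∑ i, b i * z i) ∧
        ∀ f ∈ F, ∃ (ε : K) (e : Fin 3 → ℤ), ε ∈ locAtCentre C O ∧ O.valuation ε = 1 ∧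
          f = ε * ∏ i, z i ^ e i := by
  classical
  have hp : p.Prime := Fact.out
  haveI : CharP K p := charP_of_injective_algebraMap (algebraMap k K).injective p
  -- ## the small field `k₀ = k^p ⊆ k`, acting on `K` through `k`
  set k₀ : Subfield k := (frobenius k p).fieldRange with hk₀def
  letI : Algebra k₀ K := Algebra.compHom K k₀.subtype
  haveI inst1 := IsScalarTower.of_algebraMap_eq (R := k₀) (S := k) (A := K) (fun _ => rfl)
  have halg₀ : ∀ c : k₀, algebraMap k₀ K c = algebraMap k K (c : k) := fun _ => rfl
  have hFrob : ∀ c : k, ∃ c₀ : k₀, algebraMap k₀ K c₀ = algebraMap k K c ^ p := fun c =>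
    ⟨⟨c ^ p, RingHom.mem_fieldRange.mpr ⟨c, frobenius_def _ _⟩⟩, by rw [halg₀, map_pow]⟩
  have hk₀p : ∀ c₀ : k₀, ∃ d : K, algebraMap k₀ K c₀ = d ^ p := fun c₀ => by
    obtain ⟨d, hd⟩ := RingHom.mem_fieldRange.mp c₀.2
    refine ⟨algebraMap k K d, ?_⟩
    rw [halg₀, ← map_pow, ← frobenius_def, hd]
  obtain ⟨t, ht⟩ := id hAfg
  -- ## the two-field core
  obtain ⟨A₂, hA₂O, hA₂fg, hAp, hR₂M, hreg₂, z₂, hspan₂, hdimR₂, hz0, hfac⟩ :=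
    TwoField.port_monomialModel_core₂ p hFrob hk₀p hLU hEmb O A hAO hAfg hdimA hdim3 hzd t ht g₀ M hM F hFM hF0
  haveI := hreg₂
  -- ## conversion to `K`-terms
  obtain ⟨G₂, hG₂⟩ := hA₂fg
  have hC : A₂.toSubring = Subring.closure (Set.range (fun c : k => algebraMap k K c ^ p) ∪ (G₂ : Set K)) := by
    rw [← hG₂, Algebra.adjoin_eq_ring_closure]
    congr 1
    ext x
    simp only [Set.mem_union, Set.mem_range]
    constructor
    · rintro (⟨c, rfl⟩ | hx)
      · obtain ⟨d, hd⟩ := RingHom.mem_fieldRange.mp c.2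
        refine Or.inl ⟨d, ?_⟩
        rw [← map_pow, ← frobenius_def, hd, halg₀]
      · exact Or.inr hx
    · rintro (⟨c, rfl⟩ | hx)
      · refine Or.inl ⟨⟨c ^ p, RingHom.mem_fieldRange.mpr ⟨c, frobenius_def _ _⟩⟩, ?_⟩
        rw [halg₀, map_pow]
      · exact Or.inr hx
  have hG₂O : ∀ g ∈ G₂, g ∈ O := fun g hg =>
    hA₂O (show g ∈ A₂ by rw [← hG₂]; exact Algebra.subset_adjoin hg)
  have hApC : ∀ a ∈ A, a ^ p ∈ A₂.toSubring := fun a ha => hAp a ha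
  refine ⟨G₂, A₂.toSubring, hG₂O, hC, hApC, hR₂M, fun i => (z₂ i : K), fun i => (z₂ i).2, ?_, hz0, ?_, ?_⟩
  · intro i
    have hi : z₂ i ∈ maximalIdeal _ := by rw [← hspan₂]; exact Ideal.subset_span ⟨i, rfl⟩
    exact (mem_maximalIdeal_locAtCentre_iff hA₂O _).mp hi
  · intro r hr hvr
    have hm : (⟨r, hr⟩ : locAtCentre A₂.toSubring O) ∈ maximalIdeal _ :=
      (mem_maximalIdeal_locAtCentre_iff hA₂O _).mpr hvr
    rw [← hspan₂, Ideal.mem_span_range_iff_exists_fun] at hm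
    obtain ⟨b, hb⟩ := hm
    refine ⟨fun i => (b i : K), fun i => (b i).2, ?_⟩
    have h := congrArg (fun w : locAtCentre A₂.toSubring O => (w : K)) hb
    simp only at h
    rw [← h]
    push_cast
    rfl
  · intro f hf
    obtain ⟨ε, e, hε, hεv, hfe⟩ := hfac f hf
    exact ⟨ε, e, hε, hεv, hfe⟩


/-! ## §F∞ The base change `T⁺ = Σ_s b_s T` for an ARBITRARY `p`-spanning family (finitely supported sums; new) -/

/-- **Base-change lemma, arbitrary `p`-rank.**  With `C = k^p[G₂]`, `T := locAtCentre C O ⊆ M` with parameters `z` spanning `𝔪_T`, and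
`A₂ := k[G₂]`: `A₂` is the `C`-SPAN of the family `B = b` (a `C`-submodule closed under products: `B_s B_t ∈ k = Σ_fin k^p b_u`),
`T⁺ := locAtCentre A₂ O = Σ_fin B_s T` (Frobenius on finite sums: denominators have `p`-th powers in `C`), `𝔪_{T⁺} = (z) T⁺` (by RG on
the finite support of an element of value `< 1`), `dim T⁺ = 3` (✓ `centre_closed_and_dim_three_of_pow_mem`), hence `T⁺` is REGULAR with
the same regular system of parameters.  PROVED. [folklore] -/
theorem basechange_modelInf (p : ℕ) [Fact p.Prime] {k : Type} [Field k] [CharP k p] {K : Type} [Field K] [Algebra k K]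
    (O : ValuationSubring K) (A : Subalgebra k K) (hAO : A.toSubring ≤ O.toSubring) (hAfg : A.FG) [IsFractionRing A K]
    (hdimA : ringKrullDim A ≤ 3) (hdim3 : ringKrullDim (locAtCentre A.toSubring O) = 3)
    (hzd : ∀ (T : Subring K) (hT : T ≤ O.toSubring), A.toSubring ≤ T → (subringCentre T O hT).IsMaximal)
    (t : Finset K) (ht : Algebra.adjoin k (t : Set K) = A)
    (M : Subfield K) {S : Type} (b : S → k) (hb : IsPSpanningFamilyInf p b)
    (hRG : ∀ (s : Finset S) (c : ↥s → K), (∀ i, c i ∈ M) →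
      O.valuation (∑ i : ↥s, c i * algebraMap k K (b i)) = Finset.univ.sup (fun i => O.valuation (c i)))
    (G₂ : Finset K) (hG₂O : ∀ g ∈ G₂, g ∈ O) (C : Subring K)
    (hC : C = Subring.closure (Set.range (fun c : k => algebraMap k K c ^ p) ∪ (G₂ : Set K)))
    (hApC : ∀ a ∈ A, a ^ p ∈ C) (hCM : ∀ r : K, r ∈ locAtCentre C O → r ∈ M)
    (z : Fin 3 → K) (hzC : ∀ i, z i ∈ locAtCentre C O) (hzv : ∀ i, O.valuation (z i) < 1)
    (hzspan : ∀ r : K, r ∈ locAtCentre C O → O.valuation r < 1 →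
      ∃ b : Fin 3 → K, (∀ i, b i ∈ locAtCentre C O) ∧ r = ∑ i, b i * z i) :
    ∃ (A₂ : Subalgebra k K) (_ : A₂.toSubring ≤ O.toSubring), A₂.FG ∧ (∀ a ∈ A, a ^ p ∈ A₂) ∧
      C ≤ A₂.toSubring ∧
      (∀ r : K, r ∈ locAtCentre A₂.toSubring O →
        ∃ (s : Finset S) (c : S → K), (∀ i, c i ∈ locAtCentre C O) ∧ (∀ i ∉ s, c i = 0) ∧
          r = ∑ i ∈ s, c i * algebraMap k K (b i)) ∧
      ∃ (_ : IsRegularLocalRing (locAtCentre A₂.toSubring O)) (zT : Fin 3 → locAtCentre A₂.toSubring O),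
        (∀ i, (zT i : K) = z i) ∧
        Ideal.span (Set.range zT) = IsLocalRing.maximalIdeal (locAtCentre A₂.toSubring O) ∧
        ringKrullDim (locAtCentre A₂.toSubring O) = 3 := by
  classical
  have hp : p.Prime := Fact.out
  haveI : CharP K p := charP_of_injective_algebraMap (algebraMap k K).injective p
  have hk : ∀ c : k, algebraMap k K c ∈ O := fun c => hAO (A.algebraMap_mem c)
  have htA : ∀ a ∈ (t : Set K), a ∈ A := fun a ha => by rw [← ht]; exact Algebra.subset_adjoin ha
  set B : S → K := fun s => algebraMap k K (b s) with hBdef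
  set A₂ : Subalgebra k K := Algebra.adjoin k (G₂ : Set K) with hA₂def
  -- (a) `A₂ ⊆ O`, finitely generated, contains `C` (hence the `p`-th powers of `A`)
  let Oₖ : Subalgebra k K := { O.toSubring with algebraMap_mem' := fun c => hk c }
  have hA₂Ok : A₂ ≤ Oₖ := Algebra.adjoin_le (fun g hg => hG₂O g (Finset.mem_coe.mp hg))
  have hA₂O : A₂.toSubring ≤ O.toSubring := fun x hx => hA₂Ok hx
  have hA₂fg : A₂.FG := ⟨G₂, rfl⟩
  have hCA₂ : C ≤ A₂.toSubring := by
    rw [hC, Subring.closure_le]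
    rintro x (⟨c, rfl⟩ | hx)
    · exact A₂.pow_mem (A₂.algebraMap_mem c) p
    · exact Algebra.subset_adjoin hx
  have hApA₂ : ∀ a ∈ A, a ^ p ∈ A₂ := fun a ha => hCA₂ (hApC a ha)
  have hG₂C : ∀ g ∈ G₂, g ∈ C := fun g hg => by rw [hC]; exact Subring.subset_closure (Or.inr (Finset.mem_coe.mpr hg))
  have hkC : ∀ c : k, algebraMap k K c ^ p ∈ C := fun c => by rw [hC]; exact Subring.subset_closure (Or.inl ⟨c, rfl⟩)
  -- (e1)+(e2) `A₂ ⊆ Σ_fin C · B_s`: the `C`-span of the family is closed under products and contains `G₂` and the constants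
  set V : Submodule C K := Submodule.span C (Set.range B) with hVdef
  have hBV : ∀ s, B s ∈ V := fun s => Submodule.subset_span ⟨s, rfl⟩
  have hkV : ∀ c : k, algebraMap k K c ∈ V := by
    intro c
    obtain ⟨s, d, hd⟩ := hb c
    rw [hd, map_sum]
    refine sum_mem fun u _ => ?_
    rw [map_mul, map_pow]
    have : algebraMap k K (d u) ^ p * B u = (⟨algebraMap k K (d u) ^ p, hkC _⟩ : C) • B u := by
      rw [Subring.smul_def, smul_eq_mul]
    rw [this]
    exact V.smul_mem _ (hBV u)
  have h1V : (1 : K) ∈ V := by have := hkV 1; rwa [map_one] at this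
  have hCV : ∀ x ∈ C, x ∈ V := fun x hx => by
    have : x = (⟨x, hx⟩ : C) • (1 : K) := by rw [Subring.smul_def, smul_eq_mul, mul_one]
    rw [this]; exact V.smul_mem _ h1V
  have hBmulV : ∀ s, ∀ y ∈ V, B s * y ∈ V := by
    intro s y hy
    induction hy using Submodule.span_induction with
    | mem x hx =>
      obtain ⟨u, rfl⟩ := hx
      have : B s * B u = algebraMap k K (b s * b u) := by rw [map_mul]
      rw [this]; exact hkV _
    | zero => rw [mul_zero]; exact V.zero_mem
    | add x y _ _ hx hy => rw [mul_add]; exact V.add_mem hx hy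
    | smul a x _ hx => rw [mul_smul_comm]; exact V.smul_mem a hx
  have hmulV : ∀ x ∈ V, ∀ y ∈ V, x * y ∈ V := by
    intro x hx y hy
    induction hx using Submodule.span_induction with
    | mem x hx' => obtain ⟨s, rfl⟩ := hx'; exact hBmulV s y hy
    | zero => rw [zero_mul]; exact V.zero_mem
    | add x₁ x₂ _ _ h₁ h₂ => rw [add_mul]; exact V.add_mem h₁ h₂
    | smul a x _ hx => rw [smul_mul_assoc]; exact V.smul_mem a hx
  have hA₂V : ∀ x ∈ A₂, x ∈ V := by
    intro x hx
    rw [hA₂def] at hx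
    induction hx using Algebra.adjoin_induction with
    | mem x hx => exact hCV x (hG₂C x (Finset.mem_coe.mp hx))
    | algebraMap c => exact hkV c
    | add x y _ _ hx hy => exact V.add_mem hx hy
    | mul x y _ _ hx hy => exact hmulV x hx y hy
  have hrepr : ∀ x ∈ A₂, ∃ (s : Finset S) (c : S → K), (∀ i, c i ∈ C) ∧ (∀ i ∉ s, c i = 0) ∧
      x = ∑ i ∈ s, c i * B i := by
    intro x hx
    obtain ⟨c, hc⟩ := (Finsupp.mem_span_range_iff_exists_finsupp).mp (hA₂V x hx)
    refine ⟨c.support, fun i => (c i : K), fun i => (c i).2, fun i hi => ?_, ?_⟩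
    · show ((c i : C) : K) = 0
      rw [Finsupp.notMem_support_iff.mp hi]; rfl
    · rw [← hc, Finsupp.sum]
      exact Finset.sum_congr rfl fun i _ => Subring.smul_def _ _
  -- (e3) `T⁺ = Σ_fin B_s · locAtCentre C O` (denominators have `p`-th powers in `C`)
  have hfrobC : ∀ x ∈ A₂, x ^ p ∈ C := by
    intro x hx
    obtain ⟨s, c, hcC, -, rfl⟩ := hrepr x hx
    rw [sum_pow_char]
    exact sum_mem fun i _ => by
      rw [mul_pow]
      exact mul_mem (C.pow_mem (hcC i) p) (hkC (b i))
  have hTspan : ∀ r : K, r ∈ locAtCentre A₂.toSubring O →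
      ∃ (s : Finset S) (c : S → K), (∀ i, c i ∈ locAtCentre C O) ∧ (∀ i ∉ s, c i = 0) ∧
        r = ∑ i ∈ s, c i * B i := by
    intro r hr
    obtain ⟨y, hy, w, hw, hwv, rfl⟩ := mem_locAtCentre_iff.mp hr
    have hw0 : w ≠ 0 := ne_zero_of_valuation_eq_one hwv
    have hywA₂ : y * w ^ (p - 1) ∈ A₂ := mul_mem hy (pow_mem hw _)
    obtain ⟨s, e, heC, he0, he⟩ := hrepr _ hywA₂
    have hwpC : w ^ p ∈ C := hfrobC w hw
    have hwpv : O.valuation (w ^ p) = 1 := by rw [map_pow, hwv, one_pow]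
    refine ⟨s, fun i => e i / w ^ p, fun i => mem_locAtCentre_iff.mpr ⟨e i, heC i, w ^ p, hwpC, hwpv, rfl⟩,
      fun i hi => by show e i / w ^ p = 0; rw [he0 i hi, zero_div], ?_⟩
    have hp1 : w ^ p = w ^ (p - 1) * w := by rw [← pow_succ, Nat.sub_add_cancel hp.one_le]
    have key : y / w = (y * w ^ (p - 1)) / w ^ p := by
      rw [hp1]
      field_simp
    rw [key, he, Finset.sum_div]
    exact Finset.sum_congr rfl fun i _ => by rw [mul_div_right_comm]
  -- (f) `T⁺`: local, Noetherian, `dim = 3`, `𝔪 = (z)`, regular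
  haveI hTloc : IsLocalRing (locAtCentre A₂.toSubring O) := isLocalRing_locAtCentre hA₂O
  haveI : IsLocalization.AtPrime (locAtCentre A₂.toSubring O) (subringCentre A₂.toSubring O hA₂O) :=
    isLocalization_locAtCentre hA₂O
  letI : Algebra k A₂.toSubring := inferInstanceAs (Algebra k A₂)
  haveI : Algebra.FiniteType k A₂.toSubring := (A₂.fg_iff_finiteType.mp hA₂fg : Algebra.FiniteType k A₂)
  haveI hTnoeth : IsNoetherianRing (locAtCentre A₂.toSubring O) :=
    IsLocalization.isNoetherianRing (subringCentre A₂.toSubring O hA₂O).primeCompl (locAtCentre A₂.toSubring O)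
      (Algebra.FiniteType.isNoetherianRing k A₂.toSubring)
  have hdimAeq : ringKrullDim A = 3 := ringKrullDim_eq_three_of_locAtCentre O A hAO hdimA hdim3
  obtain ⟨-, -, hdimT⟩ := centre_closed_and_dim_three_of_pow_mem hp.pos O A hAO hAfg hdimAeq t ht hzd A₂ hA₂O hA₂fg
    (fun a ha => hApA₂ a (htA a ha))
  have hTT : locAtCentre C O ≤ locAtCentre A₂.toSubring O := locAtCentre_mono O hCA₂
  set zT : Fin 3 → locAtCentre A₂.toSubring O := fun i => ⟨z i, hTT (hzC i)⟩ with hzTdef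
  have hBA₂ : ∀ s, B s ∈ A₂ := fun s => A₂.algebraMap_mem (b s)
  have hBT : ∀ s, B s ∈ locAtCentre A₂.toSubring O := fun s => le_locAtCentre _ O (hBA₂ s)
  have hspan : Ideal.span (Set.range zT) = maximalIdeal (locAtCentre A₂.toSubring O) := by
    apply le_antisymm
    · rw [Ideal.span_le]
      rintro _ ⟨i, rfl⟩
      exact (mem_maximalIdeal_locAtCentre_iff hA₂O _).mpr (hzv i)
    · intro r hr
      have hvr : O.valuation (r : K) < 1 := (mem_maximalIdeal_locAtCentre_iff hA₂O r).mp hr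
      obtain ⟨s, c, hcT, -, hcr⟩ := hTspan _ r.2
      have hcM : ∀ i, c i ∈ M := fun i => hCM _ (hcT i)
      have hcr' : (r : K) = ∑ i : ↥s, c i * B i := by rw [hcr, ← Finset.sum_coe_sort]
      have hsup : Finset.univ.sup (fun i : ↥s => O.valuation (c i)) < 1 := by
        rw [← hRG s (fun i => c i) (fun i => hcM i), ← hcr']; exact hvr
      have hci : ∀ i : ↥s, O.valuation (c i) < 1 := fun i =>
        lt_of_le_of_lt (Finset.le_sup (f := fun i : ↥s => O.valuation (c i)) (Finset.mem_univ i)) hsup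
      choose bb hbbT hbb using fun i : ↥s => hzspan (c i) (hcT i) (hci i)
      have hrsum : r = ∑ i : ↥s, ∑ j : Fin 3,
          ((⟨bb i j, hTT (hbbT i j)⟩ : locAtCentre A₂.toSubring O) * ⟨B i, hBT i⟩) * zT j := by
        apply Subtype.ext
        push_cast
        rw [hcr']
        refine Finset.sum_congr rfl fun i _ => ?_
        rw [hbb i, Finset.sum_mul]
        refine Finset.sum_congr rfl fun j _ => ?_
        simp only [hzTdef]
        ring
      rw [hrsum]
      exact Ideal.sum_mem _ fun i _ => Ideal.sum_mem _ fun j _ => Ideal.mul_mem_left _ _ (Ideal.subset_span ⟨j, rfl⟩)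
  have hdimT3 : ringKrullDim (locAtCentre A₂.toSubring O) = ((3 : ℕ) : WithBot ℕ∞) := by rw [hdimT]; norm_cast
  have hreg : IsRegularLocalRing (locAtCentre A₂.toSubring O) := by
    refine IsRegularLocalRing.of_spanFinrank_maximalIdeal_le _ ?_
    rw [hdimT3, ← hspan]
    have hgen : (Ideal.span (Set.range zT)).spanFinrank ≤ 3 := by
      refine (Submodule.spanFinrank_span_le_ncard_of_finite (Set.finite_range _)).trans ?_
      rw [← Set.image_univ]
      refine (Set.ncard_image_le Set.finite_univ).trans ?_
      rw [Set.ncard_univ, Nat.card_eq_fintype_card, Fintype.card_fin]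
    exact_mod_cast hgen
  exact ⟨A₂, hA₂O, hA₂fg, hApA₂, hCA₂, hTspan, hreg, zT, fun i => rfl, hspan, hdimT⟩

end Summit.ResolutionOfSingularities.ResolutionOfSingularities.Theorems.RadicialJungCleanModels.Lens5TFrame

end
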